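import Summits.BirchSwinnertonDyer.Rank1Residual.X2.NonsplitBDPExists
import Summits.BirchSwinnertonDyer.Rank1Residual.X11b.RouteR1IntReceptacle
import Summits.BirchSwinnertonDyer.Rank1Residual.X11b.BDPRouteHsiehFrame
import Summits.BirchSwinnertonDyer.Rank1Residual.X11b.LambdaSupplyPrime
import HarnessLib

/-!
# O9 ∩ {non-split} over the WIDE receptacle `𝓞_{ℂ_p}⟦T⟧`, definitions half: the two halves re-typed
# ♭ and H1♭ from Hsieh 2014 Thm. 1 (PUB) + the tree theorem `X11b.lambdaSupplyAt` — the residual c1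
# (`HsiehFrameResidualAt`) is NOT NEEDED (cell `bsd-eis`, seat `bsd-eis-k5-c4`; route `EisensteinPrimes`,
# crux 4 `BSDpOnCellC`, line b1: atoms c1 and c2¬split, RULING L7)

HONEST FRAMING (cell `bsd-eis`): theorems + two hypothesis-shaped `@[conjecture]` predicates (the ♭
halves); nothing booked; X2 stays CONSTRUCTION-SHAPED; no label moves. The (b1) road of the non-split
O9 display (`X2/NonsplitBDPExists.lean` p404147, `X2/NonsplitHalvesOnTree.lean` p404695,
`X2/NonsplitCellCClass.lean` p407684; registered skeleton b1 of crux 4, stubs `stub_c1_hsiehFrameResidual`,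
`stub_c2_nonsplitBDPValue`, …) produces its BDP frame `(Ω_K, Ω_p, L ∈ R₀⟦T⟧)` from Hsieh 2014 Thm. 1
(PUBLISHED, image-free, `p` odd, `π_p` special allowed) THROUGH the residual
`X2.HsiehFrameResidualAt W p` = (λ) an auxiliary anticyclotomic Hecke character with a `p`-adic avatar
through `κ` ∧ (R₀) the `R₀ = 𝓞(ℚ̂_p^ur)`-descent of every Hsieh witness (unprinted at a reducible
`p ∣ N`; x11b3-lit1 L59: Castella's own `Tw_{ψ⁻¹}` descent fails when `k(K,p) ≥ 1`). Both halves of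
that residual are UNNECESSARY for the kernel inference, exactly as the X11b cell found for class X11b
(route R1 gen 23 `X11b/RouteR1IntReceptacle.lean`: "`R₀` was never load-bearing"; route p2 gen 24
`X11b/BDPRouteHsiehFrame.lean`; gen 25 `X11b/LambdaSupplyPrime.lean`):

* (λ) is the tree THEOREM `X11b.lambdaSupplyAt` (every odd `p`, every imaginary quadratic `K`, every
  anticyclotomic `κ`; class field theory, Weil 1956 / Greenberg 1987 / Washington §13.1), whose
  conclusion is VERBATIM the (λ)-clause of `HsiehFrameResidualAt`;
* (R₀) is not needed: `BSD_p` reads only `ord_p` of a constant term in `ℂ_p`, and the pointwise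
  algebra CTL₀ ∧ H3 ∧ H2 ⟹ `IMCWaldspurgerOnTreeAt` holds over `𝓞_{ℂ_p}⟦T⟧`
  (`X11b.R1.imcWaldspurgerOnTreeAt_of_intHalves`); a Hsieh witness `(A, Ω_K, C, Ω_p, Q ∈ 𝓞_{ℂ_p}⟦T⟧)`
  becomes a Castella-normalised ♭-frame with NO descent (`X11b.exists_isBDPLFunctionInt_of_isHsiehLFunction`).

Contents (the assemblies are the companion file `X2/NonsplitHalvesOnTreeInt.lean`; the class level
`X2/NonsplitCellCClassInt.lean`):
* §1 the ♭ halves (hypothesis-shaped, `@[conjecture]`; the v1 bodies of `NonsplitBDPValueOnTree` /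
  `NonsplitIMCEqOnTree` with the receptacle widened: `L : UnrSeries p` ↦ `Q : PowerSeries 𝓞_ℂ_[p]`,
  `IsBDPLFunction` ↦ `X11b.R1.IsBDPLFunctionInt`, `Ω_p ∈ R₀ˣ` ↦ `‖Ω_p‖ = 1`, H2/H3 ↦ H2♭/H3♭):
  **`NonsplitBDPValueOnTreeInt W p`** (c2♭) and **`NonsplitIMCEqOnTreeInt W p`** (c3♭). Same print
  status as v1 (∀-frame SHAPES: c2♭ = Castella JIMJ 17 Thm. 2.11 shape, PUB at `p ≥ 5` for Castella's
  own frame, NOT in print at `p = 3 ‖ N`, and for a general frame a period-comparison is implicit;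
  c3♭ = Keller–Yin Thm. D shape, PREPRINT with the L1754 gap). NOTHING asserted.
* §2 **`exists_isBDPLFunctionInt_of_hsieh2014_of_classX2`** — H1♭ at EVERY X2 datum (either sign of
  the reduction; `p` odd; `N = N_E`; `K` imaginary quadratic with the classical Heegner hypothesis, so
  `p ∣ N` splits; `𝔭 ∋ p` and `ι'` inducing `𝔭`; `κ` anticyclotomic with generator `γ`) from Hsieh
  2014 Thm. 1 ALONE: `∃ (Ω_K ≠ 0) (Ω_p, ‖Ω_p‖ = 1) (Q ∈ 𝓞_{ℂ_p}⟦T⟧), R1.IsBDPLFunctionInt p ι' 𝔭 κ γ f Ω_K Ω_p Q`.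
  NO residual, NO irreducibility, NO semistability, NO `p ≥ 5`.

What this is NOT: not a proof of c1 as registered (`HsiehFrameResidualAt W p` keeps its (R₀) half,
which may be false for some `K`); not a discharge of c2/c3 (their ♭ forms are hypotheses); §2 is
sign-free, but the split road's statements are seat cgshw's (`X2/SplitHalvesOnTree`). CONDITIONAL on
every listed binder; nothing booked; no label change.

References: [Hsieh2014] Thm. 1 (arXiv:1112.1580 pp. 3–4), p. 7 (`Λ = Z̄_p⟦Γ⁻⟧`); [Castella2018]
Thm. 3.1, Thm. 3.2 (arXiv:1704.06608 p. 9); [Castella2018Exceptional] Thm. 2.11 (arXiv:1507.04260 p. 14);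
[KellerYin2024] Thm. D = v2 Thm. 5.1.3 (PRE); [Weil1956] §1–2; [Greenberg1987] §2; [Washington1997] §13.1.
-/

set_option autoImplicit false

noncomputable section

open scoped Classical MatrixGroups ModularForm

open CongruenceSubgroup WeierstrassCurve NumberField IsDedekindDomain Field PowerSeries
  Literature.NumberTheory.EllipticCurves Literature.NumberTheory.EllipticCurves.GreenbergSelmer
  Literature.NumberTheory.EllipticCurves.ModularForms
  Literature.NumberTheory.EllipticCurves.Rank1Residual
  Literature.NumberTheory.EllipticCurves.Rank1Residual.Typed
  Literature.NumberTheory.EllipticCurves.GreenbergVatsal2000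
  Literature.NumberTheory.EllipticCurves.Wuthrich2014
  Literature.NumberTheory.EllipticCurves.SteinWuthrich2013
  Literature.NumberTheory.GaloisRepresentations Literature.NumberTheory.GaloisCohomology
  Literature.NumberTheory.Automorphic
  Summit.BirchSwinnertonDyer.Rank1Residual.X11b.AcSelmer
  Summit.BirchSwinnertonDyer.Rank1Residual.X11b.Halves
  Summit.BirchSwinnertonDyer.Rank1Residual.X11b

namespace Summit.BirchSwinnertonDyer.Rank1Residual.X2


/-! ### §1 The two halves over the wide receptacle (hypothesis-shaped) -/

section HalvesInt

variable (W : WeierstrassCurve ℚ) [W.IsElliptic] [W.IsGloballyMinimal] (p : ℕ) [Fact p.Prime]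

/-- **c2♭ = H2♭ on the X2 ∩ {non-split} Heegner datum (value at `𝟙`), typed over `𝓞_{ℂ_p}`-frames.**
The body of `NonsplitBDPValueOnTree W p` (p404147) VERBATIM with the receptacle widened: for every CGLS
Heegner datum of a rank-one X2 pair at a NON-split `p` — level `N = N_E`, `K` imaginary quadratic with
`d_K < −4`, the classical Heegner hypothesis for `N`, `L(E^{d_K},1) ≠ 0`, Heegner datum `(Dt, H)` with
`p ∤ c` and Heegner point `P` of infinite order, anticyclotomic `(κ, γ)`, a degree-one `𝔭 ∋ p` —,
every newform `f` of `E`, every embedding datum `ι'` inducing `𝔭`, and every ♭-frame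
`(Ω_K ≠ 0, Ω_p with ‖Ω_p‖ = 1, Q ∈ 𝓞_{ℂ_p}⟦T⟧)` with `X11b.R1.IsBDPLFunctionInt p ι' 𝔭 κ γ f Ω_K Ω_p Q`:
`Q(𝟙) = u·((1 − a_p(E)·p⁻¹)·log_{ω_E} P)²` with `‖u‖ = 1` (`X11b.R1.BDPValueAtOneIntAt`, `log` through
THE embedding `embAt K p 𝔭`). PRINT STATUS as for v1: PUB shape at `p ≥ 5` (Castella JIMJ 17
Thm. 2.11, `a_p(f)` symbolic, for CASTELLA's frame; for a general frame a comparison of periods is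
implicit), NOT in print at `p = 3 ‖ N`. A predicate on `(W, p)`; TYPED, not attempted; nothing asserted;
consumed as a hypothesis. [cite: Castella2018, Thm. 3.2 (arXiv:1704.06608 p. 9) (shape only; nothing asserted)]
[cite: Castella2018Exceptional, Thm. 2.11 (arXiv:1507.04260 p. 14) (printed value formula, p ≥ 5, p-new weight 2, either sign)]
[cite: Hsieh2014, Thm. 1 and p. 7 (arXiv:1112.1580) (the receptacle `Z̄_p⟦Γ⁻⟧ ⊆ 𝓞_{ℂ_p}⟦T⟧`)] -/
@[conjecture]
def NonsplitBDPValueOnTreeInt : Prop :=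
  ∀ (N : ℕ) [NeZero N] (K : Type) [Field K] [NumberField K] (Dt : ModularParametrizationData W N)
    (H : HeegnerDatum N (NumberField.discr K)) (ιK : K →+* ℂ) (P : (W.baseChange K).toAffine.Point),
    CellC W p → ¬ W.HasSplitMultiplicativeReductionAtPrime p → W.conductorNorm ℤ = N →
    IsImaginaryQuadratic K → NumberField.discr K < -4 → SatisfiesHeegnerHypothesis N K →
    (W.quadraticTwist (NumberField.discr K : ℚ)).entireLFunction 1 ≠ 0 →
    WeierstrassCurve.Affine.Point.map ιK.toRatAlgHom P = heegnerPointComplex Dt H →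
    ¬ (p : ℤ) ∣ Dt.c → ¬ IsOfFinAddOrder P →
    ∀ (κ : ZpExtension K p), κ.IsAnticyclotomic →
      ∀ (γ : Field.absoluteGaloisGroup K) [Fact (κ.IsTopGenerator γ)]
        (𝔭 : HeightOneSpectrum (𝓞 K)) (h𝔭 : ((p : ℕ) : 𝓞 K) ∈ 𝔭.asIdeal)
        (he : 𝔭.asIdeal.ramificationIdx (𝓞 ℚ) = 1) (hf : 𝔭.asIdeal.inertiaDeg (𝓞 ℚ) = 1),
        ∀ (f : CuspForm (CongruenceSubgroup.Gamma0 N) 2), IsNewformOf W f →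
          ∀ (ι' : PadicAlgCl p ≃+* ℂ),
            (∀ (w : InfinitePlace K) (k : 𝓞 K),
              k ∈ 𝔭.asIdeal ↔ ‖ι'.symm (w.embedding (k : K))‖ < 1) →
            ∀ (ΩK : ℂ) (Ωp : ℂ_[p]) (Q : PowerSeries 𝓞_ℂ_[p]), ΩK ≠ 0 → ‖Ωp‖ = 1 →
              R1.IsBDPLFunctionInt p ι' 𝔭 κ γ f ΩK Ωp Q →
                R1.BDPValueAtOneIntAt W p (embAt K p 𝔭 h𝔭 he hf) P Q (W.LFunction p)

/-- **c3♭ = H3♭ on the X2 ∩ {non-split} Heegner datum (anticyclotomic IMC for THAT `Q`), typed over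
`𝓞_{ℂ_p}`-frames.** The body of `NonsplitIMCEqOnTree W p` (p404147) VERBATIM with the receptacle
widened: for the same data, newform, embedding datum and every ♭-frame `(Ω_K, Ω_p, Q)` with
`X11b.R1.IsBDPLFunctionInt p ι' 𝔭 κ γ f Ω_K Ω_p Q`: `Ch_Λ(X_ac^∅(E[p^∞]))·𝓞_{ℂ_p}⟦T⟧ = (Q)` for the
constructed `X_ac` at `𝔭` (`X11b.R1.IMCEqIntAt`; equality of principal ideals of the domain
`𝓞_{ℂ_p}⟦T⟧`). PRINT STATUS as for v1: Keller–Yin Thm. D = v2 Thm. 5.1.3 SHAPE ("`(𝔛_f)Λ^ur = (𝓛_f)`"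
at an odd Eisenstein `p ‖ N`): PREPRINT WITH GAP at L1754 (the text proves D′: μ = 0 and λ-equality;
char-ideal form = D′ + (α) or D′ + R-β — cgshw MEMO-5/6/8, `X2/NonsplitIMCEqHalves.lean`). A predicate
on `(W, p)`; NEVER a theorem in this cell; every result using it is CONDITIONAL.
[claim: KellerYin2024, status: under-review]
[cite: Hsieh2014, Thm. 1 and p. 7 (arXiv:1112.1580) (the receptacle `Z̄_p⟦Γ⁻⟧ ⊆ 𝓞_{ℂ_p}⟦T⟧`)] -/
@[conjecture]
def NonsplitIMCEqOnTreeInt : Prop :=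
  ∀ (N : ℕ) [NeZero N] (K : Type) [Field K] [NumberField K] (Dt : ModularParametrizationData W N)
    (H : HeegnerDatum N (NumberField.discr K)) (ιK : K →+* ℂ) (P : (W.baseChange K).toAffine.Point),
    CellC W p → ¬ W.HasSplitMultiplicativeReductionAtPrime p → W.conductorNorm ℤ = N →
    IsImaginaryQuadratic K → NumberField.discr K < -4 → SatisfiesHeegnerHypothesis N K →
    (W.quadraticTwist (NumberField.discr K : ℚ)).entireLFunction 1 ≠ 0 →
    WeierstrassCurve.Affine.Point.map ιK.toRatAlgHom P = heegnerPointComplex Dt H →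
    ¬ (p : ℤ) ∣ Dt.c → ¬ IsOfFinAddOrder P →
    ∀ (κ : ZpExtension K p), κ.IsAnticyclotomic →
      ∀ (γ : Field.absoluteGaloisGroup K) [Fact (κ.IsTopGenerator γ)]
        (𝔭 : HeightOneSpectrum (𝓞 K)), ((p : ℕ) : 𝓞 K) ∈ 𝔭.asIdeal →
        𝔭.asIdeal.ramificationIdx (𝓞 ℚ) = 1 → 𝔭.asIdeal.inertiaDeg (𝓞 ℚ) = 1 →
        ∀ (f : CuspForm (CongruenceSubgroup.Gamma0 N) 2), IsNewformOf W f →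
          ∀ (ι' : PadicAlgCl p ≃+* ℂ),
            (∀ (w : InfinitePlace K) (k : 𝓞 K),
              k ∈ 𝔭.asIdeal ↔ ‖ι'.symm (w.embedding (k : K))‖ < 1) →
            ∀ (ΩK : ℂ) (Ωp : ℂ_[p]) (Q : PowerSeries 𝓞_ℂ_[p]), ΩK ≠ 0 → ‖Ωp‖ = 1 →
              R1.IsBDPLFunctionInt p ι' 𝔭 κ γ f ΩK Ωp Q →
                R1.IMCEqIntAt W p κ 𝔭 γ Q

end HalvesInt

/-! ### §2 H1♭ at every X2 datum from Hsieh 2014 Thm. 1 alone (no residual) -/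

section Existence

variable (W : WeierstrassCurve ℚ) [W.IsElliptic] (p : ℕ) [Fact p.Prime]

/-- **H1♭ at EVERY X2 datum — either sign of the reduction at `p` — from HSIEH 2014, Thm. 1
(PUBLISHED) ALONE.** For `(E,p)` in X2 (`p` odd, `E[p]` reducible, `p` multiplicative), `N = N_E`, `f`
a newform of `E`, `K` imaginary quadratic with the classical Heegner hypothesis for `N` (so `p ∣ N`
splits), a prime `𝔭 ∋ p` of `K` and an embedding datum `ι' : ℚ̄_p ≃ ℂ` inducing it, an anticyclotomic
`ℤ_p`-extension `κ` with topological generator `γ`: THERE IS a ♭-frame `(Ω_K ≠ 0, Ω_p with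
‖Ω_p‖ = 1, Q ∈ 𝓞_{ℂ_p}⟦T⟧)` with Castella's interpolation property `X11b.R1.IsBDPLFunctionInt p ι' 𝔭 κ γ f
Ω_K Ω_p Q`. Proof: the λ-supply is the tree theorem `X11b.lambdaSupplyAt` (odd `p`); Hsieh's
hypotheses from the datum (`p ≠ 2`; `IsNewform0 f`; `p² ∤ N_E`, `p ∣ N_E` from `Mult`; `p` split from
the Heegner hypothesis at `p ∣ N_E`; `𝔭`, `ι'`, `κ`, `γ` as given); the ♭-glue
`X11b.exists_isBDPLFunctionInt_of_isHsiehLFunction` (Castella normalisation, NO `R₀`-descent). Compared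
with `exists_isBDPLFunction_of_hsieh2014_of_not_split` (p404147): the binder `hres : HsiehFrameResidualAt
W p` is GONE and the sign hypothesis is not needed. NO irreducibility, NO square-freeness, NO `p ≥ 5`.
CONDITIONAL on the named fact `hH` (published); nothing booked.
[cite: Hsieh2014, Thm. 1 (arXiv:1112.1580 pp. 3–4)] [cite: Castella2018, Thm. 3.1 (arXiv:1704.06608 p. 9) (shape of the conclusion)]
[cite: Washington1997, §13.1 (the λ-supply, via `X11b.lambdaSupplyAt`)] -/
theorem exists_isBDPLFunctionInt_of_hsieh2014_of_classX2
    (hH : hsieh2014_exists_anticyclotomicPAdicLFunction) (ι' : PadicAlgCl p ≃+* ℂ)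
    {K : Type} [Field K] [NumberField K] (𝔭 : HeightOneSpectrum (𝓞 K)) (κ : ZpExtension K p)
    (γ : Field.absoluteGaloisGroup K) {N : ℕ} [NeZero N]
    {f : CuspForm (CongruenceSubgroup.Gamma0 N) 2} (hfW : IsNewformOf W f) (hX : ClassX2 W p)
    (hN : W.conductorNorm ℤ = N) (hK : IsImaginaryQuadratic K) (hHN : SatisfiesHeegnerHypothesis N K)
    (h𝔭 : ((p : ℕ) : 𝓞 K) ∈ 𝔭.asIdeal)
    (hι' : ∀ (w : InfinitePlace K) (k : 𝓞 K), k ∈ 𝔭.asIdeal ↔ ‖ι'.symm (w.embedding (k : K))‖ < 1)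
    (hκ : κ.IsAnticyclotomic) (hγ : κ.IsTopGenerator γ) :
    ∃ (ΩK : ℂ) (Ωp : ℂ_[p]) (Q : PowerSeries 𝓞_ℂ_[p]),
      ΩK ≠ 0 ∧ ‖Ωp‖ = 1 ∧ R1.IsBDPLFunctionInt p ι' 𝔭 κ γ f ΩK Ωp Q := by
  obtain ⟨lam, rlam, hunit, hinfl, hAQ, hunrl, havl, hfacl⟩ := lambdaSupplyAt hX.1 ι' K κ hK hκ
  have hpN : p ∣ N := hN ▸ X11b.dvd_conductorNorm_of_mult (W := W) hX.2.2
  have hp2N : ¬ p ^ 2 ∣ N :=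
    hN ▸ _root_.Summit.BirchSwinnertonDyer.Rank1Residual.X2.not_sq_dvd_conductorNorm_of_mult W p hX.2.2
  obtain ⟨A, ΩK, C, Ωp, Q, hA, hΩK, hC, hΩp, hQ⟩ := hH ι' K 𝔭 κ γ f lam rlam hX.1 hfW.1 hp2N hK
    (hHN p Fact.out hpN) h𝔭 hι' hHN hunit hinfl hAQ hunrl havl hfacl hκ hγ
  obtain ⟨ΩK₁, c, hΩK₁, -, hBDP⟩ :=
    X11b.exists_isBDPLFunctionInt_of_isHsiehLFunction ι' 𝔭 κ γ f hpN hA hΩK hC Ωp hQ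
  exact ⟨ΩK₁, Ωp, _, hΩK₁, hΩp, hBDP⟩

end Existence

end Summit.BirchSwinnertonDyer.Rank1Residual.X2

end
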